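import Mathlib.Analysis.Complex.Schwarz
import Literature.MathematicalPhysics.QuantumFieldTheory.Balaban1983to89.T4TowerRateDischarge
import Literature.MathematicalPhysics.QuantumFieldTheory.Balaban1983to89.B14Radii
import Summits.QuantumFields.YangMills.Theorems.BalabanUVNodesSpineRates

/-!
# BalabanUVNodes ∕ N19 — the hypothesis-only bracket (T) of `T4OutputRate.u3_threeBrackets` in the PRINTED CHART:
# the (I.1.13) ∕ [III] (2.39) TUBE, one complex parameter per PAIR of backgrounds (Schwarz lemma on one disc), margin
# `κ₁·α_{1,j}` = (2.28)·(2.39) VERBATIM — no chart `ι`, no regularity functional `dev`, no modulus `Λ`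
# (cell `pub-ymgap`, HUMAN RULING D-0062 Track A, node N19 = NE7, R134 seat dag-n19-c g2, strategy s1′; count-neutral)

HONEST FRAMING.  One fixed finite four-torus, rung (B)+1 (existence AND uniqueness of the `ε → 0` limit of Bałaban's
unit-scale averaged loop expectations) — NOT infinite volume, NOT OS on ℝ⁴, NOT a mass gap, NOT the Clay problem.  NE7
(`Spine.NE7.Core` ∕ `T4MatchingAssembly.HybridNE7`) is NOT PRINTED and NOT proved here; N19 is NOT discharged.  THEOREMS
ONLY; 0 `def`; 0 `sorry`; standard axioms.  Nothing of Bałaban's is instantiated: the pair-disc functions `f`, the carriers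
and the letters are PARAMETERS (NODE O ∕ the record predicate `RRec` instantiate them).  Filed `--supports` the K3 item
`SpineGivenEndpointR11`; NOT a discharge claim.

WHICH BRACKET (as in `BalabanUVNodesN19LipBracketNestedRadii`, p451781, this seat's g0): of the three brackets of
`T4OutputRate.u3_threeBrackets` (`Literature/…/T4OutputRate.lean` :227) the one factor that is no DAG node's statement and
is a RAW component of the N19′ link reading at the spine carriers is the argument bracket's Lipschitz factor
**(T) = `LipBackground R.u3.EA R.u3.W R.u3.κ CU ∧ PolyLipGrowth CU g Pg q ∧ 0 ≤ Pg`**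
(`Summits/QuantumFields/YangMills/Theorems/BalabanUVNodesN19RateEdgeByName.lean` :203).

WHY A SECOND READING.  `…N19LipBracketNestedRadii` produces (T) through the tree's Cauchy road
`T4TowerRateDischarge.lipBackground_of_analyticMargin`: ONE global chart `ι : BgA → E` into a complex normed space with a
ball about EVERY embedded background, the margin derived from nested levels of a regularity functional `dev` with ONE
one-sided modulus `Λ` UNIFORM in the coupling, the domain, the background AND the scale — the referee's located
«load-bearing bet» (dag-ref-F act-(iv) READ #16: if the modulus in the chart grew with the scale, the derived margin would
not be `≥ c₀g_j` with a scale-free `c₀`).  Print defines the analyticity space otherwise ([Balaban1987RG1] (1.13) p. 262,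
[Balaban1988RG2Cluster] p. 15 «by the definition of the space, 𝐔 = U′U, U′ = exp iL⁻¹ηA′, … |A′|, |∇A′| < α₁»,
[Balaban1988Convergent] (2.39) p. 261 «Lⁿξ|A′|, (Lⁿξ)²|∇^ξ_U A′| < (1 − β(1 − 2^{−(j−n)}))α_{1,n}»): a union of TUBES
about regular backgrounds, linear only in the direction `A′`.  Reading (2.27)(ii) through the tube needs, per PAIR of
backgrounds `(U, U′)` at gauge `δ`, ONE holomorphic function of ONE complex variable `s` on the disc `|s| < ϱ` — the term
along `s ↦ exp(iξ(s∕δ)Z)·U` with `Z` the connecting direction — through `E(U)` at `0` and `E(U′)` at the real point `δ`,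
bounded by `E₀e^{−κd}` ((2.27)(iv) ∕ (I.1.18)); the Schwarz lemma gives `|E(U) − E(U′)| ≤ (2E₀e^{−κd}∕ϱ)·δ`, far pairs by
the triangle inequality; and the radius is (2.39) ITSELF: `ϱ = κ₁·α_{1,j}`, `α_{1,j} = g_jC₁(log g_j⁻²)^{q₁}` (2.28), with
the layer factor `κ₁ ∈ {1 = shrink β 0, shrink β m > 3∕4}` (`B14Radii.shrink`, `three_quarters_lt_shrink`).  NO `ι`, NO
`dev`, NO `Λ`, NO level gap, NO `p₀ ≤ q₀`: the margin reading (MR) «`ϱ ≥ c₀g_j`» that `T4TowerRateDischarge` §2 flags NOT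
PRINTED is, for the tube, `couplingMargin_alphaJ` with `c₀ = κ₁C₁` — printed verbatim.  (Lens decomposition
`pub-ymgap/ym-lens-BalabanUVNodes-decomp/LENS-decomp.md` pieces T-a, T-c; §1's proof is adapted from that seat's
farm-checked sketch `LensDecompNE7.sketch.lean` :`lipBackground_of_tubeAnalytic`, with the shape INLINED — credited.)

WHAT THIS FILE PROVES (every Bałaban clause a HYPOTHESIS SHAPE over the abstract carriers, never a fact):
* §1 `lipBackground_of_pairDisc` — pair-disc holomorphy through the two real values with the (1.18) bound on the disc, plus
  the real decay bound `DecayBound` ((1.18) printed form), give `LipBackground EA W κ (2E₀∕ϱ)`; `decayBound_of_pairDisc` —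
  when the gauge vanishes on the diagonal the real bound is already contained; `lipBackground_of_pairDisc_of_gaugeSelf`.
* §2 the radius in coupling units: `radius_ge_mul_coupling` (`κ₁C₁·g ≤ κ₁α(C₁,q₁,g)` for `g² ≤ e⁻¹`), `radius_pos`,
  `rad239_ge_mul_coupling` ((2.39) in the tree's typed letters `B14Radii.rad239`: `(3∕4)C₁·g ≤ rad239 β (α(C₁,q₁,g)) j n`
  for the printed `β ≤ 1∕4`), and the layer-comparability arithmetic `alphaJ_le_mul_alphaJ_of_le` (below).
* §3 `lipBackground_of_pairDisc_alphaJ`, `polyLipGrowth_of_pairDisc_alphaJ` (ONE CALL of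
  `T4TowerRateDischarge.polyLipGrowth_of_couplingMargin`, `c₀ = κ₁C₁`, exponent `1`, constant `(2E₀∕κ₁C₁)(1∕gIR + √β′)`),
  **`lipBracket_of_pairDisc`**: `∃ CU Pg, LipBackground EA W κ CU ∧ PolyLipGrowth CU gA Pg 1 ∧ 0 ≤ Pg`.
* §4 **`lipBracket_at_u3Carriers_of_pairDisc`** ∕ `lipBracket_at_rateCarriers_of_pairDisc` — LITERALLY the component (T)
  of `N19RateEdgeByName.rateEdge_of_linkReading_byName` (its `q := 1`) at node U3's carriers `YMDAG.UVSplit.U3Carriers` ∕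
  `RateCarriers.u3`, from: `DecayBound u.EA u.W E₀ u.κ`; the pair-disc shape at radius `κ₁·alphaJ C₁ q₁ (s j)`; the signs
  `0 ≤ E₀`, `0 < κ₁`, `0 < C₁`; the window's smallness `0 < s_j`, `s_j² ≤ e⁻¹`; run A's tables `g K ∈ u.W` with the upper
  running `1∕(g K j)² ≤ 1∕gIR² + β′(K − j)` ((2.6) ∕ (0.31)) — eleven binders against `…NestedRadii` §4's twenty-two.
* COMPANION `BalabanUVNodesN19LipBracketTubeWitness` (split off under the 400-line rule): (§5 there) THE TUBE ROAD
  SUBSUMES THE TREE'S — the global-chart data of `lipBackground_of_analyticMargin` GIVE the pair-disc shape at the same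
  radius (restrict the extension to the complex line through `ι U` towards `ι U′`), hence the tree's conclusion and the
  `…NestedRadii` §3 with the constant HALVED (`2E₀∕ϱ` for `4E₀∕ϱ`); (§6 there) NON-VACUITY of §1's
  hypothesis set on `T4TowerRateComposition.toyCarriers` (`E₀e^{−ϱ}cos U`, discs of radius `ϱ`).

WHAT REMAINS HYPOTHESIS (census of (T) in this reading; owners per the lens): the pair-disc shape ON BAŁABAN'S CARRIERS OF
RECORD — i.e. that the tube path stays in `Ũᶜ_j(X)` for `|s| < κ₁α_{1,j}`: clause (iii) (2.39) is membership BY DEFINITION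
once the gauge is the chart's `A′`-size; the bold-𝐔 ∕ 𝐉 clauses (2.34) ∕ (2.36) along the tube (`…NestedRadiiWitness` §5: the plaquette
deviation is locally Lipschitz — printed KIND); the local small-gauge clause (2.38) (regular-spaces ∕ Landau-gauge papers:
N04 ∕ N05 by name); the derived-minimiser clauses (iv) ∕ (2.35)(2.37) for COMPLEX data ([Balaban1987RG1] p. 262 (iv) citing
[15] = [Balaban1985Variational] Prop. 9 — one-run, printed; N07's interface); the (1.18) bound on the tube ((2.27)(iv),
one-run, printed); the J-coordinate ((I.1.9): both arguments move — N16's (Q)∕(C)∕(Gᶜ) rates); NODE O's UNIT TABLE.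
LOCATED (not resolved here, two items for the instancer): (a) the C¹ CURRENCY — (1.13)∕(2.39) bound `|A′|` AND `|∇_U A′|`,
so a v8 of the link reading should read NE3's closeness with the value AND the covariant-gradient component of
`Spine.NE3.CovariantRoot.closeness_of_ne3EnergyRateWCov` ((P) `θ^{8k}`, (Gᶜ) `θ^{13k}`), glue = the lens's
`localRate_of_components`, unit check `Lθ⁸ = L^{−1∕3} < 1`, `L²θ^{13} = L^{−1∕6} < 1` at `θ⁶ = L⁻¹`; (b) the LAYERS — the
pair-disc radius is indexed by the creation scale `j = scale X` alone (as is `LipBackground`'s constant family), while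
(2.39) on the layer `X ∩ (Ω_n∖Ω_{n+1})` reads `shrink β (j−n)·α_{1,n}` with the layer weight `Lⁿξ`; in the unweighted
`|A′|`-currency the binding layer is the creation layer `n = j` as soon as `α_{1,j} ≤ (Lⁿξ)⁻¹·shrink·α_{1,n}`-type
comparabilities hold along the flow — `alphaJ_le_mul_alphaJ_of_le` is the arithmetic (`α(C,q,g) ≤ M·α(C,q,g′)` for
`g′ ≤ g ≤ Mg′`, `g ≤ 1`); which comparability the record's flow supplies ((2.6)) is the instancer's line, not this file's.

CITATION HEADER (LOCATIONS only, as transcribed in the headers of the imported modules `T4OutputRate`,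
`T4TowerRateDischarge`, `B14`, `B14Radii` and in the lens note; no decl below carries a cite tag).  [Balaban1987RG1]
T. Bałaban, CMP **109** (1987) 249–301 — (1.9)–(1.16) p. 262, (1.17)–(1.18) p. 263.  [Balaban1988Convergent] T. Bałaban,
CMP **119** (1988) 243–285 — (2.6) p. 255, (2.27)(ii)(iv), (2.28) p. 259, (2.34)–(2.39) p. 261, p. 277.
[Balaban1988RG2Cluster] T. Bałaban, CMP **116** (1988) 1–22 — p. 15.  [DimockYuan2024GNFlow] proof of Thm 4 (the Cauchy
device of the tree's road).  Mathlib: `Complex.dist_le_div_mul_dist_of_mapsTo_ball` (Schwarz lemma).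
-/

open Metric Set

namespace Summit.QuantumFields.YangMills.BalabanUVNodes.N19LipBracketTube

open Literature.MathematicalPhysics.QuantumFieldTheory.Balaban1983to89
open T4OutputRate (Carriers Functional DecayBound LipBackground)
open T4TowerRateComposition (PolyLipGrowth)
open T4TowerRateDischarge (alphaJ_ge_mul polyLipGrowth_of_couplingMargin)

/-! ## §1 The pair-disc Schwarz step: ONE holomorphic function of ONE complex variable per pair of backgrounds -/

section PairDisc

variable {C : Carriers}

/-- **PAIR-DISC HOLOMORPHY ⇒ `LipBackground` WITH CONSTANT `2E₀∕ϱ`** (lens piece T-a; the (1.13)∕(2.39) TUBE chart read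
pair by pair).  DATA over the abstract carriers (ALL HYPOTHESIS SHAPES): a radius family `ϱ g j > 0`; the real decay bound
`DecayBound EA W E₀ κ` ((1.18), printed form); and, for every admissible `g`, domain `X` and pair `(U, U′)` of run-A
backgrounds at gauge `< ϱ g (scale X)`, SOME function `f : ℂ → ℂ` holomorphic on the disc `|z| < ϱ g (scale X)` with
`f 0 = E(X; g, U)`, `f (gauge U U′) = E(X; g, U′)` and `‖f‖ ≤ E₀e^{−κd(X)}` on the disc (intended instance, NODE O: the term
along the tube `s ↦ (exp(iξ(s∕δ)Z)·U, J-path)`, (2.27)(ii)+(iv)).  CONCLUSION: `LipBackground EA W κ (2E₀∕ϱ)` — close pairs by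
the Schwarz lemma `Complex.dist_le_div_mul_dist_of_mapsTo_ball` (the disc maps into the closed `2E₀e^{−κd}`-ball about
`f 0`), far pairs (`gauge ≥ ϱ`) by the triangle inequality.  Proof adapted from the lens seat's sketch
(`ym-lens-BalabanUVNodes-decomp`, `lipBackground_of_tubeAnalytic`). [folklore] -/
theorem lipBackground_of_pairDisc {EA : Functional C C.BgA} {W : Set (ℕ → ℝ)} {κ E₀ : ℝ} {ϱ : (ℕ → ℝ) → ℕ → ℝ}
    (hϱ : ∀ g ∈ W, ∀ j, 0 < ϱ g j) (hdecay : DecayBound EA W E₀ κ)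
    (hdisc : ∀ g ∈ W, ∀ (X : C.Dom) (U U' : C.BgA), C.gauge U U' < ϱ g (C.scale X) →
      ∃ f : ℂ → ℂ, DifferentiableOn ℂ f (ball (0 : ℂ) (ϱ g (C.scale X))) ∧ f 0 = (EA g U X : ℂ) ∧
        f (C.gauge U U' : ℂ) = (EA g U' X : ℂ) ∧
        ∀ z ∈ ball (0 : ℂ) (ϱ g (C.scale X)), ‖f z‖ ≤ E₀ * Real.exp (-(κ * C.d X))) :
    LipBackground EA W κ (fun g j => 2 * E₀ / ϱ g j) := by
  intro g hg U U' X
  set ρ := ϱ g (C.scale X) with hρdef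
  set δ := C.gauge U U' with hδdef
  set M := E₀ * Real.exp (-(κ * C.d X)) with hMdef
  have hρ : 0 < ρ := hϱ g hg _
  have hδ0 : 0 ≤ δ := C.gauge_nonneg U U'
  by_cases hlt : δ < ρ
  · obtain ⟨f, hf, hf0, hf1, hfb⟩ := hdisc g hg X U U' hlt
    have hmaps : MapsTo f (ball (0 : ℂ) ρ) (closedBall (f 0) (2 * M)) := by
      intro z hz
      rw [mem_closedBall, dist_eq_norm]
      calc ‖f z - f 0‖ ≤ ‖f z‖ + ‖f 0‖ := norm_sub_le _ _
        _ ≤ M + M := add_le_add (hfb z hz) (hfb 0 (mem_ball_self hρ))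
        _ = 2 * M := by ring
    have hz : (δ : ℂ) ∈ ball (0 : ℂ) ρ := by
      rw [mem_ball, dist_zero_right, Complex.norm_real, Real.norm_eq_abs, abs_of_nonneg hδ0]
      exact hlt
    have hS := Complex.dist_le_div_mul_dist_of_mapsTo_ball hf hmaps hz
    rw [hf1, hf0, dist_zero_right, Complex.norm_real, Real.norm_eq_abs, abs_of_nonneg hδ0,
      Complex.dist_eq, ← Complex.ofReal_sub, Complex.norm_real, Real.norm_eq_abs, abs_sub_comm] at hS
    calc |EA g U X - EA g U' X| ≤ 2 * M / ρ * δ := hS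
      _ = 2 * E₀ / ρ * Real.exp (-(κ * C.d X)) * δ := by rw [hMdef]; ring
  · have hge : ρ ≤ δ := not_lt.mp hlt
    have h1 : |EA g U X - EA g U' X| ≤ 2 * M := by
      calc |EA g U X - EA g U' X| ≤ |EA g U X| + |EA g U' X| := abs_sub _ _
        _ ≤ M + M := add_le_add (hdecay g hg U X) (hdecay g hg U' X)
        _ = 2 * M := by ring
    have hM0 : 0 ≤ M := (abs_nonneg _).trans (hdecay g hg U X)
    have h2 : 2 * M ≤ 2 * M / ρ * δ := by
      rw [div_mul_eq_mul_div, le_div_iff₀ hρ]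
      exact mul_le_mul_of_nonneg_left hge (by positivity)
    calc |EA g U X - EA g U' X| ≤ 2 * M / ρ * δ := h1.trans h2
      _ = 2 * E₀ / ρ * Real.exp (-(κ * C.d X)) * δ := by rw [hMdef]; ring

/-- **THE REAL BOUND IS CONTAINED** (bookkeeping): if the carrier's gauge vanishes on the diagonal (`gauge U U = 0`; the
abstract `T4OutputRate.Carriers` records only `gauge ≥ 0`), the pair-disc shape at the pair `(U, U)` already gives the
printed decay bound `DecayBound EA W E₀ κ` of the real values ((I.1.18)), from `f 0 = E(X; g, U)` and the disc bound at the
centre. [folklore] -/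
theorem decayBound_of_pairDisc {EA : Functional C C.BgA} {W : Set (ℕ → ℝ)} {κ E₀ : ℝ} {ϱ : (ℕ → ℝ) → ℕ → ℝ}
    (hϱ : ∀ g ∈ W, ∀ j, 0 < ϱ g j) (hself : ∀ U : C.BgA, C.gauge U U = 0)
    (hdisc : ∀ g ∈ W, ∀ (X : C.Dom) (U U' : C.BgA), C.gauge U U' < ϱ g (C.scale X) →
      ∃ f : ℂ → ℂ, DifferentiableOn ℂ f (ball (0 : ℂ) (ϱ g (C.scale X))) ∧ f 0 = (EA g U X : ℂ) ∧
        f (C.gauge U U' : ℂ) = (EA g U' X : ℂ) ∧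
        ∀ z ∈ ball (0 : ℂ) (ϱ g (C.scale X)), ‖f z‖ ≤ E₀ * Real.exp (-(κ * C.d X))) :
    DecayBound EA W E₀ κ := by
  intro g hg U X
  obtain ⟨f, -, hf0, -, hfb⟩ := hdisc g hg X U U (by rw [hself]; exact hϱ g hg _)
  have h := hfb 0 (mem_ball_self (hϱ g hg _))
  rwa [hf0, Complex.norm_real, Real.norm_eq_abs] at h

/-- The two together: with a gauge vanishing on the diagonal, the pair-disc shape ALONE gives `LipBackground` with
`2E₀∕ϱ`. [folklore] -/
theorem lipBackground_of_pairDisc_of_gaugeSelf {EA : Functional C C.BgA} {W : Set (ℕ → ℝ)} {κ E₀ : ℝ}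
    {ϱ : (ℕ → ℝ) → ℕ → ℝ} (hϱ : ∀ g ∈ W, ∀ j, 0 < ϱ g j) (hself : ∀ U : C.BgA, C.gauge U U = 0)
    (hdisc : ∀ g ∈ W, ∀ (X : C.Dom) (U U' : C.BgA), C.gauge U U' < ϱ g (C.scale X) →
      ∃ f : ℂ → ℂ, DifferentiableOn ℂ f (ball (0 : ℂ) (ϱ g (C.scale X))) ∧ f 0 = (EA g U X : ℂ) ∧
        f (C.gauge U U' : ℂ) = (EA g U' X : ℂ) ∧
        ∀ z ∈ ball (0 : ℂ) (ϱ g (C.scale X)), ‖f z‖ ≤ E₀ * Real.exp (-(κ * C.d X))) :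
    LipBackground EA W κ (fun g j => 2 * E₀ / ϱ g j) :=
  lipBackground_of_pairDisc hϱ (decayBound_of_pairDisc hϱ hself hdisc) hdisc

end PairDisc

/-! ## §2 The tube radius in coupling units: (2.28) and (2.39) verbatim -/

section Radius

/-- **THE TUBE RADIUS IS AT LEAST LINEAR IN THE COUPLING** (lens piece T-c): with the printed radius shape (2.28)
`α_{1,j} = g_jC₁(log g_j⁻²)^{q₁}` (tree `B14.alphaJ`) and a layer factor `κ₁ ≥ 0` (`1 = shrink β 0` at the creation layer,
`shrink β m > 3∕4` in general), `κ₁C₁·g ≤ κ₁·α(C₁, q₁, g)` for `0 < g`, `g² ≤ e⁻¹` — the margin reading (MR) of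
`T4TowerRateDischarge` §2 with `c₀ = κ₁C₁`, one line over `alphaJ_ge_mul`. [folklore] -/
theorem radius_ge_mul_coupling {κ₁ C₁ g : ℝ} (q₁ : ℕ) (hκ₁ : 0 ≤ κ₁) (hC₁ : 0 ≤ C₁) (hg : 0 < g)
    (hsmall : g ^ 2 ≤ Real.exp (-1)) : κ₁ * C₁ * g ≤ κ₁ * B14.alphaJ C₁ q₁ g := by
  have h := alphaJ_ge_mul q₁ hC₁ hg hsmall
  calc κ₁ * C₁ * g = κ₁ * (C₁ * g) := by ring
    _ ≤ κ₁ * B14.alphaJ C₁ q₁ g := mul_le_mul_of_nonneg_left h hκ₁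

/-- Positivity of the tube radius on the small window (`κ₁, C₁ > 0`). [folklore] -/
theorem radius_pos {κ₁ C₁ g : ℝ} (q₁ : ℕ) (hκ₁ : 0 < κ₁) (hC₁ : 0 < C₁) (hg : 0 < g)
    (hsmall : g ^ 2 ≤ Real.exp (-1)) : 0 < κ₁ * B14.alphaJ C₁ q₁ g :=
  lt_of_lt_of_le (by positivity) (radius_ge_mul_coupling q₁ hκ₁.le hC₁.le hg hsmall)

/-- **(2.39) VERBATIM, IN COUPLING UNITS**: the typed right-hand side `B14Radii.rad239 β α₁n j n = shrink β (j − n)·α₁n`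
of (2.39) p. 261 «Lⁿξ|A′|, (Lⁿξ)²|∇^ξ_U A′| < (1 − β(1 − 2^{−(j−n)}))α_{1,n}», at `α₁n = α(C₁, q₁, g)` (2.28) and the printed
`β ≤ 1∕4` («e.g., we can take β = 1∕4»), is `≥ (3∕4)C₁·g` for `0 < g`, `g² ≤ e⁻¹` (`B14Radii.three_quarters_lt_shrink`).
[folklore] -/
theorem rad239_ge_mul_coupling {β C₁ g : ℝ} (q₁ j n : ℕ) (hβ : β ≤ 1 / 4) (hC₁ : 0 ≤ C₁) (hg : 0 < g)
    (hsmall : g ^ 2 ≤ Real.exp (-1)) : 3 / 4 * C₁ * g ≤ B14Radii.rad239 β (B14.alphaJ C₁ q₁ g) j n := by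
  unfold B14Radii.rad239
  have h1 := B14Radii.three_quarters_lt_shrink hβ (j - n)
  have h2 := alphaJ_ge_mul q₁ hC₁ hg hsmall
  have h3 : 0 ≤ C₁ * g := mul_nonneg hC₁ hg.le
  calc 3 / 4 * C₁ * g = 3 / 4 * (C₁ * g) := by ring
    _ ≤ B14Radii.shrink β (j - n) * (C₁ * g) := mul_le_mul_of_nonneg_right h1.le h3
    _ ≤ B14Radii.shrink β (j - n) * B14.alphaJ C₁ q₁ g := mul_le_mul_of_nonneg_left h2 (by linarith)

/-- **LAYER COMPARABILITY OF THE PRINTED RADII** (the arithmetic of located item (b) of the header): for couplings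
`0 < g′ ≤ g ≤ M·g′` with `g² ≤ 1`, `α(C, q, g) ≤ M·α(C, q, g′)` (`C ≥ 0`) — the larger coupling has the smaller logarithm.
With `M = (Lⁿξ)⁻¹`-type layer weights this is what makes the creation layer the binding one in the unweighted currency;
which comparability the flow of record supplies ((2.6) p. 255) is the instancer's line. [folklore] -/
theorem alphaJ_le_mul_alphaJ_of_le {C M g g' : ℝ} (q : ℕ) (hC : 0 ≤ C) (hg' : 0 < g') (hle : g' ≤ g)
    (hM : g ≤ M * g') (hg1 : g ^ 2 ≤ 1) : B14.alphaJ C q g ≤ M * B14.alphaJ C q g' := by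
  unfold B14.alphaJ
  have hg : 0 < g := lt_of_lt_of_le hg' hle
  have hlog0 : 0 ≤ Real.log (g ^ 2)⁻¹ := by
    rw [Real.log_inv]
    have := Real.log_nonpos (by positivity : 0 ≤ g ^ 2) hg1
    linarith
  have hlogle : Real.log (g ^ 2)⁻¹ ≤ Real.log (g' ^ 2)⁻¹ := by
    rw [Real.log_inv, Real.log_inv]
    have := Real.log_le_log (by positivity : 0 < g' ^ 2) (pow_le_pow_left₀ hg'.le hle 2)
    linarith
  have hpow : (Real.log (g ^ 2)⁻¹) ^ q ≤ (Real.log (g' ^ 2)⁻¹) ^ q := pow_le_pow_left₀ hlog0 hlogle q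
  have hMg : 0 ≤ M * g' := hg.le.trans hM
  calc g * C * (Real.log (g ^ 2)⁻¹) ^ q ≤ (M * g') * C * (Real.log (g ^ 2)⁻¹) ^ q :=
        mul_le_mul_of_nonneg_right (mul_le_mul_of_nonneg_right hM hC) (pow_nonneg hlog0 q)
    _ ≤ (M * g') * C * (Real.log (g' ^ 2)⁻¹) ^ q := mul_le_mul_of_nonneg_left hpow (mul_nonneg hMg hC)
    _ = M * (g' * C * (Real.log (g' ^ 2)⁻¹) ^ q) := by ring

end Radius

/-! ## §3 The bracket (T) over abstract carriers at the tube radius `κ₁·α_{1,j}` -/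

section Bracket

variable {C : Carriers}

/-- **`LipBackground` AT THE PRINTED TUBE RADIUS.**  The real decay bound (1.18) and the pair-disc shape at radius
`κ₁·α(C₁, q₁, g_j)` ((2.27)(ii)(iv) through the (1.13)∕(2.39) tube — HYPOTHESIS SHAPES), `κ₁, C₁ > 0`, and the window's
smallness (`0 < g_j`, `g_j² ≤ e⁻¹`) give `LipBackground EA W κ (2E₀∕(κ₁α_{1,j}))` — §1 at the radius of §2. [folklore] -/
theorem lipBackground_of_pairDisc_alphaJ {EA : Functional C C.BgA} {W : Set (ℕ → ℝ)} {κ E₀ κ₁ C₁ : ℝ} {q₁ : ℕ}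
    (hdecay : DecayBound EA W E₀ κ)
    (hdisc : ∀ g ∈ W, ∀ (X : C.Dom) (U U' : C.BgA), C.gauge U U' < κ₁ * B14.alphaJ C₁ q₁ (g (C.scale X)) →
      ∃ f : ℂ → ℂ, DifferentiableOn ℂ f (ball (0 : ℂ) (κ₁ * B14.alphaJ C₁ q₁ (g (C.scale X)))) ∧
        f 0 = (EA g U X : ℂ) ∧ f (C.gauge U U' : ℂ) = (EA g U' X : ℂ) ∧
        ∀ z ∈ ball (0 : ℂ) (κ₁ * B14.alphaJ C₁ q₁ (g (C.scale X))), ‖f z‖ ≤ E₀ * Real.exp (-(κ * C.d X)))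
    (hκ₁ : 0 < κ₁) (hC₁ : 0 < C₁) (hW : ∀ g ∈ W, ∀ j, 0 < g j ∧ g j ^ 2 ≤ Real.exp (-1)) :
    LipBackground EA W κ (fun g j => 2 * E₀ / (κ₁ * B14.alphaJ C₁ q₁ (g j))) :=
  lipBackground_of_pairDisc (ϱ := fun g j => κ₁ * B14.alphaJ C₁ q₁ (g j))
    (fun g hg j => radius_pos q₁ hκ₁ hC₁ (hW g hg j).1 (hW g hg j).2) hdecay hdisc

/-- **`PolyLipGrowth` AT THE PRINTED TUBE RADIUS, EXPONENT `1`** — ONE CALL of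
`T4TowerRateDischarge.polyLipGrowth_of_couplingMargin` with `c₀ = κ₁C₁` (§2) and `E₀∕2` for `E₀`: on run A's cutoff
tables `gA K ∈ W` with the upper running `1∕(gA K j)² ≤ 1∕gIR² + β′(K − j)` ((2.6) ∕ (0.31)), the family
`2E₀∕(κ₁α_{1,j})` is `≤ (2E₀∕κ₁C₁)(1∕gIR + √β′)·(K − j + 1)`. [folklore] -/
theorem polyLipGrowth_of_pairDisc_alphaJ {W : Set (ℕ → ℝ)} {E₀ κ₁ C₁ β' gIR : ℝ} {q₁ : ℕ} {gA : ℕ → ℕ → ℝ}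
    (hE₀ : 0 ≤ E₀) (hκ₁ : 0 < κ₁) (hC₁ : 0 < C₁) (hW : ∀ g ∈ W, ∀ j, 0 < g j ∧ g j ^ 2 ≤ Real.exp (-1))
    (hgA : ∀ K, gA K ∈ W) (hup : ∀ K j, j ≤ K → 1 / gA K j ^ 2 ≤ 1 / gIR ^ 2 + β' * ((K : ℝ) - j))
    (hgIR : 0 < gIR) (hβ' : 0 ≤ β') :
    PolyLipGrowth (fun g j => 2 * E₀ / (κ₁ * B14.alphaJ C₁ q₁ (g j))) gA
      (2 * E₀ / (κ₁ * C₁) * (1 / gIR + Real.sqrt β')) 1 := by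
  have h := polyLipGrowth_of_couplingMargin (ϱ := fun g j => κ₁ * B14.alphaJ C₁ q₁ (g j)) (E₀ := E₀ / 2)
    (c₀ := κ₁ * C₁) (fun g hg j => radius_ge_mul_coupling q₁ hκ₁.le hC₁.le (hW g hg j).1 (hW g hg j).2)
    (mul_pos hκ₁ hC₁) (by positivity) hgA (fun K j _ => (hW _ (hgA K) j).1) hup hgIR hβ'
  have e : (4 : ℝ) * (E₀ / 2) = 2 * E₀ := by ring
  simp only [e] at h
  exact h

/-- **THE BRACKET (T) OVER ABSTRACT CARRIERS, TUBE READING**: `∃ CU Pg, LipBackground EA W κ CU ∧ PolyLipGrowth CU gA Pg 1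
∧ 0 ≤ Pg` — node U3's argument-bracket factor in the exact form the N19 edge consumes it, from the (1.18) real bound, the
pair-disc shape at radius `κ₁α_{1,j}`, the signs, the window's smallness and run A's tables with their upper running.
No chart, no regularity functional, no modulus, no level gap. [folklore] -/
theorem lipBracket_of_pairDisc {EA : Functional C C.BgA} {W : Set (ℕ → ℝ)} {κ E₀ κ₁ C₁ β' gIR : ℝ} {q₁ : ℕ}
    {gA : ℕ → ℕ → ℝ}
    -- (1.18) real decay bound (printed form)
    (hdecay : DecayBound EA W E₀ κ)
    -- (2.27)(ii)+(iv) THROUGH THE (1.13)∕(2.39) TUBE: pair-disc holomorphy with the (1.18) bound at radius κ₁·α_{1,j}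
    (hdisc : ∀ g ∈ W, ∀ (X : C.Dom) (U U' : C.BgA), C.gauge U U' < κ₁ * B14.alphaJ C₁ q₁ (g (C.scale X)) →
      ∃ f : ℂ → ℂ, DifferentiableOn ℂ f (ball (0 : ℂ) (κ₁ * B14.alphaJ C₁ q₁ (g (C.scale X)))) ∧
        f 0 = (EA g U X : ℂ) ∧ f (C.gauge U U' : ℂ) = (EA g U' X : ℂ) ∧
        ∀ z ∈ ball (0 : ℂ) (κ₁ * B14.alphaJ C₁ q₁ (g (C.scale X))), ‖f z‖ ≤ E₀ * Real.exp (-(κ * C.d X)))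
    -- LETTERS: signs and the window's smallness
    (hE₀ : 0 ≤ E₀) (hκ₁ : 0 < κ₁) (hC₁ : 0 < C₁) (hW : ∀ g ∈ W, ∀ j, 0 < g j ∧ g j ^ 2 ≤ Real.exp (-1))
    -- run A's cutoff tables and the upper running of the couplings ((2.6) ∕ (0.31))
    (hgA : ∀ K, gA K ∈ W) (hup : ∀ K j, j ≤ K → 1 / gA K j ^ 2 ≤ 1 / gIR ^ 2 + β' * ((K : ℝ) - j))
    (hgIR : 0 < gIR) (hβ' : 0 ≤ β') :
    ∃ (CU : (ℕ → ℝ) → ℕ → ℝ) (Pg : ℝ), LipBackground EA W κ CU ∧ PolyLipGrowth CU gA Pg 1 ∧ 0 ≤ Pg :=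
  ⟨_, _, lipBackground_of_pairDisc_alphaJ hdecay hdisc hκ₁ hC₁ hW,
    polyLipGrowth_of_pairDisc_alphaJ hE₀ hκ₁ hC₁ hW hgA hup hgIR hβ', by positivity⟩

end Bracket

/-! ## §4 AT THE SPINE CARRIERS: the component (T) of the N19′ link reading at node U3's carriers -/

section AtCarriers

open YMDAG.UVSplit (U3Carriers RateCarriers)

/-- **THE HYPOTHESIS-ONLY BRACKET AT NODE U3's CARRIERS, TUBE READING.**  For the U3 sub-bundle `u` of the K4 rate carriers
(`u.C`, `u.W`, `u.κ`, `u.EA`, shared by N18 ∕ N22 ∕ N17 ∕ (D4)) and run A's cutoff tables `g` of the N19′ link reading: from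
the real decay bound (1.18) `DecayBound u.EA u.W E₀ u.κ`, the pair-disc shape of run A's scale-`j` terms at the printed tube
radius `κ₁·α(C₁, q₁, s_j)` ((2.27)(ii)(iv) through (1.13)∕(2.39) — SHAPE, NODE O), the signs, the window's smallness and the
tables' membership + upper running ((2.6)∕(0.31)):
**`∃ CU Pg, LipBackground u.EA u.W u.κ CU ∧ PolyLipGrowth CU g Pg 1 ∧ 0 ≤ Pg`** — LITERALLY the component (T) of
`N19RateEdgeByName.rateEdge_of_linkReading_byName` (with its `q := 1`).  CONDITIONAL on every binder; nothing of Bałaban's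
instantiated; NOT NE7; N19 NOT discharged. [folklore] -/
theorem lipBracket_at_u3Carriers_of_pairDisc (u : U3Carriers) {E₀ κ₁ C₁ β' gIR : ℝ} {q₁ : ℕ} {g : ℕ → ℕ → ℝ}
    (hdecay : DecayBound u.EA u.W E₀ u.κ)
    (hdisc : ∀ s ∈ u.W, ∀ (X : u.C.Dom) (U U' : u.C.BgA),
      u.C.gauge U U' < κ₁ * B14.alphaJ C₁ q₁ (s (u.C.scale X)) →
      ∃ f : ℂ → ℂ, DifferentiableOn ℂ f (ball (0 : ℂ) (κ₁ * B14.alphaJ C₁ q₁ (s (u.C.scale X)))) ∧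
        f 0 = (u.EA s U X : ℂ) ∧ f (u.C.gauge U U' : ℂ) = (u.EA s U' X : ℂ) ∧
        ∀ z ∈ ball (0 : ℂ) (κ₁ * B14.alphaJ C₁ q₁ (s (u.C.scale X))), ‖f z‖ ≤ E₀ * Real.exp (-(u.κ * u.C.d X)))
    (hE₀ : 0 ≤ E₀) (hκ₁ : 0 < κ₁) (hC₁ : 0 < C₁) (hW : ∀ s ∈ u.W, ∀ j, 0 < s j ∧ s j ^ 2 ≤ Real.exp (-1))
    (hgA : ∀ K, g K ∈ u.W) (hup : ∀ K j, j ≤ K → 1 / g K j ^ 2 ≤ 1 / gIR ^ 2 + β' * ((K : ℝ) - j))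
    (hgIR : 0 < gIR) (hβ' : 0 ≤ β') :
    ∃ (CU : (ℕ → ℝ) → ℕ → ℝ) (Pg : ℝ), LipBackground u.EA u.W u.κ CU ∧ PolyLipGrowth CU g Pg 1 ∧ 0 ≤ Pg :=
  lipBracket_of_pairDisc hdecay hdisc hE₀ hκ₁ hC₁ hW hgA hup hgIR hβ'

/-- The same at the RATE-CARRIER BUNDLE `R : RateCarriers N` of the K4 split, read at its U3 sub-bundle `R.u3` — the
letters of `N19RateEdgeByName.rateEdge_of_linkReading_byName`'s clause verbatim (`R.u3.EA`, `R.u3.W`, `R.u3.κ`).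
[folklore] -/
theorem lipBracket_at_rateCarriers_of_pairDisc {N : ℕ} (R : RateCarriers N) {E₀ κ₁ C₁ β' gIR : ℝ} {q₁ : ℕ}
    {g : ℕ → ℕ → ℝ} (hdecay : DecayBound R.u3.EA R.u3.W E₀ R.u3.κ)
    (hdisc : ∀ s ∈ R.u3.W, ∀ (X : R.u3.C.Dom) (U U' : R.u3.C.BgA),
      R.u3.C.gauge U U' < κ₁ * B14.alphaJ C₁ q₁ (s (R.u3.C.scale X)) →
      ∃ f : ℂ → ℂ, DifferentiableOn ℂ f (ball (0 : ℂ) (κ₁ * B14.alphaJ C₁ q₁ (s (R.u3.C.scale X)))) ∧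
        f 0 = (R.u3.EA s U X : ℂ) ∧ f (R.u3.C.gauge U U' : ℂ) = (R.u3.EA s U' X : ℂ) ∧
        ∀ z ∈ ball (0 : ℂ) (κ₁ * B14.alphaJ C₁ q₁ (s (R.u3.C.scale X))),
          ‖f z‖ ≤ E₀ * Real.exp (-(R.u3.κ * R.u3.C.d X)))
    (hE₀ : 0 ≤ E₀) (hκ₁ : 0 < κ₁) (hC₁ : 0 < C₁) (hW : ∀ s ∈ R.u3.W, ∀ j, 0 < s j ∧ s j ^ 2 ≤ Real.exp (-1))
    (hgA : ∀ K, g K ∈ R.u3.W) (hup : ∀ K j, j ≤ K → 1 / g K j ^ 2 ≤ 1 / gIR ^ 2 + β' * ((K : ℝ) - j))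
    (hgIR : 0 < gIR) (hβ' : 0 ≤ β') :
    ∃ (CU : (ℕ → ℝ) → ℕ → ℝ) (Pg : ℝ),
      LipBackground R.u3.EA R.u3.W R.u3.κ CU ∧ PolyLipGrowth CU g Pg 1 ∧ 0 ≤ Pg :=
  lipBracket_at_u3Carriers_of_pairDisc R.u3 hdecay hdisc hE₀ hκ₁ hC₁ hW hgA hup hgIR hβ'

end AtCarriers

end Summit.QuantumFields.YangMills.BalabanUVNodes.N19LipBracketTube
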